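import Literature.Analysis.Hypoelliptic.SymFields
import HarnessLib

/-!
# The commutator gains of Kohn's proof, symbolically: `[X, T]` has the order of `T`

Analysis/Hypoelliptic support file, ninth piece of the Fourier-side toolkit serving the
discharge of `Literature.Analysis.Distribution.Hormander1967_thm11` by Kohn's method
(M. Taylor, *Pseudodifferential Operators* (1981), Ch. XV §1). Continues `SymFields.lean`.

The pseudo-differential fact driving Kohn's proof is that the commutator of a vector field
`X` (order `1`) with an operator `T` of order `m` built from Bessel potentials, vector fields
and multiplications is again of order `m` (gain of one derivative), and that this can be
iterated once more (`[X, [X, Λ^b]]` has order `b`). Here this is made COMPLETELY EXPLICIT on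
the symbolic operators of `Sym.lean`: recursively defined expressions

* `Sym.bcomm b A ≈ [A, Λ^b]` for a coefficient `A` (order `b - 1`, via `gcomm1`),
* `Sym.g1comm b θ A ≈ [A, gcomm1 b θ]` for a coefficient `A` (order `b - 2`, via `gcomm2`),
* `Field.fcomm X T ≈ [X, T]` for a field `X` and `T` of gain level `≤ 1` (`Sym.lev`), with
  `ord (fcomm X T) ≤ ord T` and `lev (fcomm X T) ≤ lev T + 1`,
* `Sym.ccomm A T ≈ [A, T]` for a coefficient `A`, with `ord (ccomm A T) ≤ ord T`,

together with their certificates. (Taylor 1981, Ch. II, Thm 4.4/Cor 4.5 and Ch. XV §1,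
(1.20), (1.25), "[P, T^{2ε}] = ∑ T_j A_j + T_{k+1}", in symbolic form.)

## References

* M. E. Taylor, *Pseudodifferential Operators* (1981), Ch. II §4; Ch. XV §1.
-/

noncomputable section

open MeasureTheory Set Filter Function
open scoped ENNReal NNReal Topology ComplexConjugate InnerProductSpace

namespace Literature.Analysis.Hypoelliptic

variable {V : Type*} [NormedAddCommGroup V] [InnerProductSpace ℝ V] [FiniteDimensional ℝ V]
  [MeasurableSpace V] [BorelSpace V]

namespace Sym

/-! ### Gain levels -/

section LevSyntax

omit [NormedAddCommGroup V] [InnerProductSpace ℝ V] [FiniteDimensional ℝ V] [MeasurableSpace V] [BorelSpace V]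

/-- The gain level of an expression: `0` for plain expressions, `1` if a first-gain kernel
occurs, `2` if a second-gain kernel occurs. [folklore] -/
def lev : Sym V → ℕ
  | bessel _ => 0
  | lin _ => 0
  | cmul _ => 0
  | conv _ => 0
  | gcomm1 _ _ => 1
  | gcomm2 _ _ _ => 2
  | smul _ s => lev s
  | add s t => max (lev s) (lev t)
  | comp s t => max (lev s) (lev t)

/-- (structural lemma) [folklore] -/
@[simp] theorem lev_bessel (b : ℝ) : lev (bessel b : Sym V) = 0 := rfl
/-- (structural lemma) [folklore] -/
@[simp] theorem lev_lin (v : V) : lev (lin v) = 0 := rfl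
/-- (structural lemma) [folklore] -/
@[simp] theorem lev_cmul (c : ℂ) : lev (cmul c : Sym V) = 0 := rfl
/-- (structural lemma) [folklore] -/
@[simp] theorem lev_conv (θ : V → ℂ) : lev (conv θ) = 0 := rfl
/-- (structural lemma) [folklore] -/
@[simp] theorem lev_gcomm1 (b : ℝ) (θ : V → ℂ) : lev (gcomm1 b θ) = 1 := rfl
/-- (structural lemma) [folklore] -/
@[simp] theorem lev_gcomm2 (b : ℝ) (θ' θ : V → ℂ) : lev (gcomm2 b θ' θ) = 2 := rfl
/-- (structural lemma) [folklore] -/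
@[simp] theorem lev_smul (c : ℂ) (s : Sym V) : lev (smul c s) = lev s := rfl
/-- (structural lemma) [folklore] -/
@[simp] theorem lev_add (s t : Sym V) : lev (add s t) = max (lev s) (lev t) := rfl
/-- (structural lemma) [folklore] -/
@[simp] theorem lev_comp (s t : Sym V) : lev (comp s t) = max (lev s) (lev t) := rfl
/-- (structural lemma) [folklore] -/
@[simp] theorem lev_neg (s : Sym V) : lev (neg s) = lev s := rfl
/-- (structural lemma) [folklore] -/
@[simp] theorem lev_sub (s t : Sym V) : lev (sub s t) = max (lev s) (lev t) := rfl
/-- (structural lemma) [folklore] -/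
@[simp] theorem lev_zero : lev (zero : Sym V) = 0 := rfl
/-- (structural lemma) [folklore] -/
@[simp] theorem lev_zeroOf (m : ℝ) : lev (zeroOf m : Sym V) = 0 := rfl

/-- Plain expressions have level `0`. [folklore] -/
theorem Plain.lev_eq : ∀ {s : Sym V}, Plain s → lev s = 0
  | bessel _, _ => rfl
  | lin _, _ => rfl
  | cmul _, _ => rfl
  | conv _, _ => rfl
  | gcomm1 _ _, h => h.elim
  | gcomm2 _ _ _, h => h.elim
  | smul _ s, hs => Plain.lev_eq (s := s) hs
  | add s t, ⟨hs, ht⟩ => by simp [Plain.lev_eq hs, Plain.lev_eq ht]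
  | comp s t, ⟨hs, ht⟩ => by simp [Plain.lev_eq hs, Plain.lev_eq ht]

/-- Coefficient expressions have level `0`. [folklore] -/
theorem IsCoef.lev_eq {s : Sym V} (hs : IsCoef s) : lev s = 0 := hs.plain.lev_eq

/-- The level of a nonempty sum is bounded by a common bound. [folklore] -/
theorem lev_sum_le : ∀ {l : List (Sym V)} {n : ℕ}, (∀ s ∈ l, lev s ≤ n) → lev (sum l) ≤ n
  | [], _, _ => Nat.zero_le _
  | [s], _, h => h s (List.mem_singleton_self s)
  | s :: t :: l, n, h => by
    rw [sum_cons_cons, lev_add]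
    exact max_le (h s List.mem_cons_self)
      (lev_sum_le (l := t :: l) fun u hu => h u (List.mem_cons_of_mem _ hu))

end LevSyntax

/-! ### `[A, Λ^b]` for a coefficient `A` -/

/-- **`bcomm b A ≈ [A, Λ^b]`** for a coefficient expression `A`, an expression of order
`b - 1` and level `≤ 1` (`[a, Λ^b] = -gcomm1 b (𝓕a)`, Leibniz). [folklore] -/
def bcomm (b : ℝ) : Sym V → Sym V
  | conv θ => neg (gcomm1 b θ)
  | smul c s => smul c (bcomm b s)
  | add s t => add (bcomm b s) (bcomm b t)
  | comp s t => add (comp s (bcomm b t)) (comp (bcomm b s) t)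
  | _ => zeroOf (b - 1)

omit [InnerProductSpace ℝ V] [FiniteDimensional ℝ V] [BorelSpace V] in
/-- `bcomm` is certified. [folklore] -/
theorem Cert.bcomm_cert (b : ℝ) : ∀ {A : Sym V}, IsCoef A → Cert A → Cert (bcomm b A)
  | bessel _, h, _ => h.elim
  | lin _, h, _ => h.elim
  | cmul _, _, _ => cert_zeroOf _
  | conv _, _, h => h
  | gcomm1 _ _, h, _ => h.elim
  | gcomm2 _ _ _, h, _ => h.elim
  | smul _ s, hs, hc => Cert.bcomm_cert b (A := s) hs hc
  | add _ _, ⟨hs, ht⟩, ⟨hcs, hct⟩ => ⟨Cert.bcomm_cert b hs hcs, Cert.bcomm_cert b ht hct⟩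
  | comp _ _, ⟨hs, ht⟩, ⟨hcs, hct⟩ =>
    ⟨⟨hcs, Cert.bcomm_cert b ht hct⟩, Cert.bcomm_cert b hs hcs, hct⟩

omit [NormedAddCommGroup V] [InnerProductSpace ℝ V] [FiniteDimensional ℝ V] [MeasurableSpace V] [BorelSpace V] in
/-- `bcomm b A` has order `b - 1`. [folklore] -/
theorem ord_bcomm (b : ℝ) : ∀ {A : Sym V}, IsCoef A → ord (bcomm b A) = b - 1
  | bessel _, h => h.elim
  | lin _, h => h.elim
  | cmul _, _ => rfl
  | conv _, _ => rfl
  | gcomm1 _ _, h => h.elim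
  | gcomm2 _ _ _, h => h.elim
  | smul _ s, hs => ord_bcomm b (A := s) hs
  | add s t, ⟨hs, ht⟩ => by simp [bcomm, ord_bcomm b hs, ord_bcomm b ht]
  | comp s t, ⟨hs, ht⟩ => by
    simp [bcomm, ord_bcomm b hs, ord_bcomm b ht, hs.ord_eq, ht.ord_eq]

omit [NormedAddCommGroup V] [InnerProductSpace ℝ V] [FiniteDimensional ℝ V] [MeasurableSpace V] [BorelSpace V] in
/-- `bcomm b A` has level `≤ 1`. [folklore] -/
theorem lev_bcomm_le (b : ℝ) : ∀ {A : Sym V}, IsCoef A → lev (bcomm b A) ≤ 1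
  | bessel _, h => h.elim
  | lin _, h => h.elim
  | cmul _, _ => Nat.zero_le _
  | conv _, _ => le_rfl
  | gcomm1 _ _, h => h.elim
  | gcomm2 _ _ _, h => h.elim
  | smul _ s, hs => lev_bcomm_le b (A := s) hs
  | add s t, ⟨hs, ht⟩ => by
    simp only [bcomm, lev_add]; exact max_le (lev_bcomm_le b hs) (lev_bcomm_le b ht)
  | comp s t, ⟨hs, ht⟩ => by
    simp only [bcomm, lev_add, lev_comp, hs.lev_eq, ht.lev_eq]
    exact max_le (by simpa using lev_bcomm_le b ht) (by simpa using lev_bcomm_le b hs)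

/-- **`[A, Λ^b] ≈ bcomm b A`.** [folklore] -/
theorem IsCoef.comm_bessel (b : ℝ) : ∀ {A : Sym V}, IsCoef A → Cert A →
    comm A (bessel b) ≈ bcomm b A
  | bessel _, h, _ => h.elim
  | lin _, h, _ => h.elim
  | cmul c, _, _ => (comm_cmul_left c _).zeroOf _
  | conv _, _, ⟨_, hθ⟩ => comm_conv_bessel b hθ
  | gcomm1 _ _, h, _ => h.elim
  | gcomm2 _ _ _, h, _ => h.elim
  | smul c s, hs, hc => (comm_smul_left c s _).trans ((IsCoef.comm_bessel b (A := s) hs hc).smul c)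
  | add _ _, ⟨hs, ht⟩, ⟨hcs, hct⟩ =>
    (comm_add_left hcs hct (cert_bessel b)).trans
      ((IsCoef.comm_bessel b hs hcs).add (IsCoef.comm_bessel b ht hct))
  | comp s _, ⟨hs, ht⟩, ⟨hcs, hct⟩ =>
    (comp_comm hcs hct (cert_bessel b)).trans
      (((IsCoef.comm_bessel b ht hct).comp_right s).add
        ((IsCoef.comm_bessel b hs hcs).comp_left hct))

/-! ### `[A, gcomm1 b θ]` for a coefficient `A` -/

/-- **`g1comm b θ A ≈ [A, gcomm1 b θ]`** for a coefficient expression `A`, an expression of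
order `b - 2` and level `≤ 2` (`[conv θ', gcomm1 b θ] = gcomm2 b θ' θ`, Leibniz). [folklore] -/
def g1comm (b : ℝ) (θ : V → ℂ) : Sym V → Sym V
  | conv θ' => gcomm2 b θ' θ
  | smul c s => smul c (g1comm b θ s)
  | add s t => add (g1comm b θ s) (g1comm b θ t)
  | comp s t => add (comp s (g1comm b θ t)) (comp (g1comm b θ s) t)
  | _ => zeroOf (b - 2)

omit [InnerProductSpace ℝ V] [FiniteDimensional ℝ V] [BorelSpace V] in
/-- `g1comm` is certified. [folklore] -/
theorem Cert.g1comm_cert (b : ℝ) {θ : V → ℂ} (hθ : ∃ D, RapidDecay θ D) :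
    ∀ {A : Sym V}, IsCoef A → Cert A → Cert (g1comm b θ A)
  | bessel _, h, _ => h.elim
  | lin _, h, _ => h.elim
  | cmul _, _, _ => cert_zeroOf _
  | conv _, _, h => ⟨h, hθ⟩
  | gcomm1 _ _, h, _ => h.elim
  | gcomm2 _ _ _, h, _ => h.elim
  | smul _ s, hs, hc => Cert.g1comm_cert b hθ (A := s) hs hc
  | add _ _, ⟨hs, ht⟩, ⟨hcs, hct⟩ => ⟨Cert.g1comm_cert b hθ hs hcs, Cert.g1comm_cert b hθ ht hct⟩
  | comp _ _, ⟨hs, ht⟩, ⟨hcs, hct⟩ =>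
    ⟨⟨hcs, Cert.g1comm_cert b hθ ht hct⟩, Cert.g1comm_cert b hθ hs hcs, hct⟩

omit [NormedAddCommGroup V] [InnerProductSpace ℝ V] [FiniteDimensional ℝ V] [MeasurableSpace V] [BorelSpace V] in
/-- `g1comm b θ A` has order `b - 2`. [folklore] -/
theorem ord_g1comm (b : ℝ) (θ : V → ℂ) : ∀ {A : Sym V}, IsCoef A → ord (g1comm b θ A) = b - 2
  | bessel _, h => h.elim
  | lin _, h => h.elim
  | cmul _, _ => rfl
  | conv _, _ => rfl
  | gcomm1 _ _, h => h.elim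
  | gcomm2 _ _ _, h => h.elim
  | smul _ s, hs => ord_g1comm b θ (A := s) hs
  | add s t, ⟨hs, ht⟩ => by simp [g1comm, ord_g1comm b θ hs, ord_g1comm b θ ht]
  | comp s t, ⟨hs, ht⟩ => by
    simp [g1comm, ord_g1comm b θ hs, ord_g1comm b θ ht, hs.ord_eq, ht.ord_eq]

omit [NormedAddCommGroup V] [InnerProductSpace ℝ V] [FiniteDimensional ℝ V] [MeasurableSpace V] [BorelSpace V] in
/-- `g1comm b θ A` has level `≤ 2`. [folklore] -/
theorem lev_g1comm_le (b : ℝ) (θ : V → ℂ) : ∀ {A : Sym V}, IsCoef A → lev (g1comm b θ A) ≤ 2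
  | bessel _, h => h.elim
  | lin _, h => h.elim
  | cmul _, _ => Nat.zero_le _
  | conv _, _ => le_rfl
  | gcomm1 _ _, h => h.elim
  | gcomm2 _ _ _, h => h.elim
  | smul _ s, hs => lev_g1comm_le b θ (A := s) hs
  | add s t, ⟨hs, ht⟩ => by
    simp only [g1comm, lev_add]; exact max_le (lev_g1comm_le b θ hs) (lev_g1comm_le b θ ht)
  | comp s t, ⟨hs, ht⟩ => by
    simp only [g1comm, lev_add, lev_comp, hs.lev_eq, ht.lev_eq]
    exact max_le (by simpa using lev_g1comm_le b θ ht) (by simpa using lev_g1comm_le b θ hs)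

/-- **`[A, gcomm1 b θ] ≈ g1comm b θ A`.** [folklore] -/
theorem IsCoef.comm_gcomm1 (b : ℝ) {θ : V → ℂ} {D : ℕ → ℝ} (hθ : RapidDecay θ D) :
    ∀ {A : Sym V}, IsCoef A → Cert A → comm A (gcomm1 b θ) ≈ g1comm b θ A
  | bessel _, h, _ => h.elim
  | lin _, h, _ => h.elim
  | cmul c, _, _ => (comm_cmul_left c _).zeroOf _
  | conv _, _, ⟨_, hθ'⟩ => comm_conv_gcomm1 b hθ' hθ
  | gcomm1 _ _, h, _ => h.elim
  | gcomm2 _ _ _, h, _ => h.elim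
  | smul c s, hs, hc => (comm_smul_left c s _).trans ((IsCoef.comm_gcomm1 b hθ (A := s) hs hc).smul c)
  | add _ _, ⟨hs, ht⟩, ⟨hcs, hct⟩ =>
    (comm_add_left (u := gcomm1 b θ) hcs hct ⟨D, hθ⟩).trans
      ((IsCoef.comm_gcomm1 b hθ hs hcs).add (IsCoef.comm_gcomm1 b hθ ht hct))
  | comp s _, ⟨hs, ht⟩, ⟨hcs, hct⟩ =>
    (comp_comm (u := gcomm1 b θ) hcs hct ⟨D, hθ⟩).trans
      (((IsCoef.comm_gcomm1 b hθ ht hct).comp_right s).add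
        ((IsCoef.comm_gcomm1 b hθ hs hcs).comp_left hct))

/-! ### `[A, T]` for a coefficient `A` and `T` of level `≤ 1` -/

/-- **`ccomm A T ≈ [A, T]`** for a coefficient expression `A` and `T` of level `≤ 1`: an
expression of order `≤ ord T` and level `≤ lev T + 1`. [folklore] -/
def ccomm (A : Sym V) : Sym V → Sym V
  | bessel b => bcomm b A
  | lin w => neg (lcomm w A)
  | cmul _ => zeroOf 0
  | conv _ => zeroOf 0
  | gcomm1 b θ => g1comm b θ A
  | gcomm2 b _ _ => zeroOf (b - 2)
  | smul c t => smul c (ccomm A t)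
  | add t u => add (ccomm A t) (ccomm A u)
  | comp t u => add (comp (ccomm A t) u) (comp t (ccomm A u))

omit [FiniteDimensional ℝ V] in
/-- `ccomm` is certified. [folklore] -/
theorem Cert.ccomm_cert {A : Sym V} (hA : IsCoef A) (hcA : Cert A) :
    ∀ {T : Sym V}, Cert T → Cert (ccomm A T)
  | bessel b, _ => hcA.bcomm_cert b hA
  | lin w, _ => (hcA.lcomm_cert w hA : _)
  | cmul _, _ => cert_zeroOf _
  | conv _, _ => cert_zeroOf _
  | gcomm1 b _, hθ => hcA.g1comm_cert b hθ hA
  | gcomm2 _ _ _, _ => cert_zeroOf _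
  | smul _ t, ht => Cert.ccomm_cert hA hcA (T := t) ht
  | add _ _, ⟨ht, hu⟩ => ⟨Cert.ccomm_cert hA hcA ht, Cert.ccomm_cert hA hcA hu⟩
  | comp _ _, ⟨ht, hu⟩ => ⟨⟨Cert.ccomm_cert hA hcA ht, hu⟩, ht, Cert.ccomm_cert hA hcA hu⟩

omit [FiniteDimensional ℝ V] [MeasurableSpace V] [BorelSpace V] in
/-- `ccomm A T` has order `≤ ord T`. [folklore] -/
theorem ord_ccomm_le {A : Sym V} (hA : IsCoef A) : ∀ T : Sym V, ord (ccomm A T) ≤ ord T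
  | bessel b => by rw [ccomm, ord_bcomm b hA, ord_bessel]; linarith
  | lin w => by simp [ccomm, (hA.lcomm_isCoef w).ord_eq]
  | cmul _ => le_rfl
  | conv _ => le_rfl
  | gcomm1 b θ => by rw [ccomm, ord_g1comm b θ hA, ord_gcomm1]; linarith
  | gcomm2 _ _ _ => le_rfl
  | smul _ t => ord_ccomm_le hA t
  | add t u => by
    simp only [ccomm, ord_add]
    exact max_le_max (ord_ccomm_le hA t) (ord_ccomm_le hA u)
  | comp t u => by
    simp only [ccomm, ord_add, ord_comp]
    exact max_le (add_le_add (ord_ccomm_le hA t) le_rfl)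
      (add_le_add le_rfl (ord_ccomm_le hA u))

omit [FiniteDimensional ℝ V] [MeasurableSpace V] [BorelSpace V] in
/-- `ccomm A T` has level `≤ lev T + 1`. [folklore] -/
theorem lev_ccomm_le {A : Sym V} (hA : IsCoef A) : ∀ T : Sym V, lev (ccomm A T) ≤ lev T + 1
  | bessel b => by simpa [ccomm] using lev_bcomm_le b hA
  | lin w => by simp [ccomm, (hA.lcomm_isCoef w).lev_eq]
  | cmul _ => Nat.zero_le _
  | conv _ => Nat.zero_le _
  | gcomm1 b θ => by simpa [ccomm] using lev_g1comm_le b θ hA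
  | gcomm2 _ _ _ => Nat.zero_le _
  | smul _ t => lev_ccomm_le hA t
  | add t u => by
    simp only [ccomm, lev_add]
    exact max_le ((lev_ccomm_le hA t).trans (by omega)) ((lev_ccomm_le hA u).trans (by omega))
  | comp t u => by
    simp only [ccomm, lev_add, lev_comp]
    refine max_le (max_le ((lev_ccomm_le hA t).trans (by omega)) (by omega))
      (max_le (by omega) ((lev_ccomm_le hA u).trans (by omega)))

/-- **`[A, T] ≈ ccomm A T`** for a coefficient `A` and `T` of level `≤ 1`. [folklore] -/
theorem IsCoef.comm_sym {A : Sym V} (hA : IsCoef A) (hcA : Cert A) :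
    ∀ {T : Sym V}, lev T ≤ 1 → Cert T → comm A T ≈ ccomm A T
  | bessel b, _, _ => hA.comm_bessel b hcA
  | lin w, _, _ => hA.comm_lin_right w hcA
  | cmul c, _, _ => (comm_cmul_right A c).zeroOf _
  | conv θ, _, ⟨D, hθ⟩ =>
    ((comm_antisymm _ _).trans ((IsCoef.comm_conv_left hθ hA hcA).neg)).trans
      (fun F _ => by ext ξ; simp [ccomm])
  | gcomm1 b θ, _, ⟨D, hθ⟩ => hA.comm_gcomm1 b hθ hcA
  | gcomm2 _ _ _, h, _ => by simp at h
  | smul c t, hl, ht => (comm_smul_right c A t).trans ((IsCoef.comm_sym hA hcA (T := t) hl ht).smul c)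
  | add t u, hl, ⟨ht, hu⟩ => by
    simp only [lev_add, max_le_iff] at hl
    exact (comm_add_right hcA ht hu).trans
      ((IsCoef.comm_sym hA hcA hl.1 ht).add (IsCoef.comm_sym hA hcA hl.2 hu))
  | comp t u, hl, ⟨ht, hu⟩ => by
    simp only [lev_comp, max_le_iff] at hl
    exact (comm_comp hcA ht hu).trans
      (((IsCoef.comm_sym hA hcA hl.1 ht).comp_left hu).add
        ((IsCoef.comm_sym hA hcA hl.2 hu).comp_right t))

end Sym

/-! ### `[X, T]` for a field `X` and `T` of level `≤ 1` -/

namespace Field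

open Sym

/-- **`fcomm X T ≈ [X, T]`** for a field `X = ∑_k A_k lin v_k` and `T` of level `≤ 1`: an
expression of order `≤ ord T` and level `≤ lev T + 1` — the commutator gain of Kohn's proof in
symbolic form. [folklore] -/
def fcomm (X : Field V) : Sym V → Sym V
  | bessel b => Sym.sum (X.map fun p => comp (bcomm b p.1) (lin p.2))
  | lin w => Sym.sum (X.map fun p => comp (neg (lcomm w p.1)) (lin p.2))
  | cmul _ => zeroOf 0
  | conv θ => Sym.sum (X.map fun p => comp p.1 (conv fun ζ => linMul p.2 ζ * θ ζ))
  | gcomm1 b θ => Sym.sum (X.map fun p =>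
      add (comp p.1 (gcomm1 b fun ζ => linMul p.2 ζ * θ ζ)) (comp (g1comm b θ p.1) (lin p.2)))
  | gcomm2 b _ _ => zeroOf (b - 2)
  | smul c t => smul c (fcomm X t)
  | add t u => add (fcomm X t) (fcomm X u)
  | Sym.comp t u => add (comp (fcomm X t) u) (comp t (fcomm X u))

omit [FiniteDimensional ℝ V] in
/-- `fcomm` is certified. [folklore] -/
theorem CertF.fcomm_cert {X : Field V} (hX : IsField X) (hcX : CertF X) :
    ∀ {T : Sym V}, Cert T → Cert (fcomm X T)
  | bessel b, _ => cert_sum fun s hs => by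
      obtain ⟨p, hp, rfl⟩ := List.mem_map.1 hs
      exact ⟨(hcX p hp).bcomm_cert b (hX p hp), trivial⟩
  | lin w, _ => cert_sum fun s hs => by
      obtain ⟨p, hp, rfl⟩ := List.mem_map.1 hs
      exact ⟨((hcX p hp).lcomm_cert w (hX p hp) : _), trivial⟩
  | cmul _, _ => cert_zeroOf _
  | conv _, ⟨D, hθ⟩ => cert_sum fun s hs => by
      obtain ⟨p, hp, rfl⟩ := List.mem_map.1 hs
      exact ⟨hcX p hp, ⟨_, hθ.linMul_mul p.2⟩⟩
  | gcomm1 b _, ⟨D, hθ⟩ => cert_sum fun s hs => by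
      obtain ⟨p, hp, rfl⟩ := List.mem_map.1 hs
      exact ⟨⟨hcX p hp, ⟨_, hθ.linMul_mul p.2⟩⟩, (hcX p hp).g1comm_cert b ⟨D, hθ⟩ (hX p hp), trivial⟩
  | gcomm2 _ _ _, _ => cert_zeroOf _
  | smul _ t, ht => CertF.fcomm_cert hX hcX (T := t) ht
  | add _ _, ⟨ht, hu⟩ => ⟨CertF.fcomm_cert hX hcX ht, CertF.fcomm_cert hX hcX hu⟩
  | Sym.comp _ _, ⟨ht, hu⟩ => ⟨⟨CertF.fcomm_cert hX hcX ht, hu⟩, ht, CertF.fcomm_cert hX hcX hu⟩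

omit [FiniteDimensional ℝ V] [MeasurableSpace V] [BorelSpace V] in
/-- `fcomm X T` has order `≤ ord T` (for a nonempty field). [folklore] -/
theorem ord_fcomm_le {X : Field V} (hX : IsField X) (hne : X ≠ []) :
    ∀ T : Sym V, ord (fcomm X T) ≤ ord T
  | bessel b => ord_sum_le (by simpa using hne) fun s hs => by
      obtain ⟨p, hp, rfl⟩ := List.mem_map.1 hs
      simp [ord_bcomm b (hX p hp)]
  | lin w => ord_sum_le (by simpa using hne) fun s hs => by
      obtain ⟨p, hp, rfl⟩ := List.mem_map.1 hs
      simp [((hX p hp).lcomm_isCoef w).ord_eq]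
  | cmul _ => le_rfl
  | conv _ => ord_sum_le (by simpa using hne) fun s hs => by
      obtain ⟨p, hp, rfl⟩ := List.mem_map.1 hs
      simp [(hX p hp).ord_eq]
  | gcomm1 b θ => ord_sum_le (by simpa using hne) fun s hs => by
      obtain ⟨p, hp, rfl⟩ := List.mem_map.1 hs
      simp only [ord_comp, ord_add, (hX p hp).ord_eq, ord_g1comm b θ (hX p hp), ord_gcomm1, ord_lin]
      exact max_le (by linarith) (by linarith)
  | gcomm2 _ _ _ => le_rfl
  | smul _ t => ord_fcomm_le hX hne t
  | add t u => by
    simp only [fcomm, ord_add]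
    exact max_le_max (ord_fcomm_le hX hne t) (ord_fcomm_le hX hne u)
  | Sym.comp t u => by
    simp only [fcomm, ord_add, ord_comp]
    exact max_le (add_le_add (ord_fcomm_le hX hne t) le_rfl)
      (add_le_add le_rfl (ord_fcomm_le hX hne u))

omit [FiniteDimensional ℝ V] [MeasurableSpace V] [BorelSpace V] in
/-- `fcomm X T` has level `≤ lev T + 1`. [folklore] -/
theorem lev_fcomm_le {X : Field V} (hX : IsField X) : ∀ T : Sym V, lev (fcomm X T) ≤ lev T + 1
  | bessel b => lev_sum_le fun s hs => by
      obtain ⟨p, hp, rfl⟩ := List.mem_map.1 hs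
      simpa using lev_bcomm_le b (hX p hp)
  | lin w => lev_sum_le fun s hs => by
      obtain ⟨p, hp, rfl⟩ := List.mem_map.1 hs
      simp [((hX p hp).lcomm_isCoef w).lev_eq]
  | cmul _ => Nat.zero_le _
  | conv _ => lev_sum_le fun s hs => by
      obtain ⟨p, hp, rfl⟩ := List.mem_map.1 hs
      simp [(hX p hp).lev_eq]
  | gcomm1 b θ => lev_sum_le fun s hs => by
      obtain ⟨p, hp, rfl⟩ := List.mem_map.1 hs
      simp only [lev_add, lev_comp, (hX p hp).lev_eq, lev_gcomm1, lev_lin]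
      exact max_le (by simp) (max_le (lev_g1comm_le b θ (hX p hp)) (by simp))
  | gcomm2 _ _ _ => Nat.zero_le _
  | smul _ t => lev_fcomm_le hX t
  | add t u => by
    simp only [fcomm, lev_add]
    exact max_le ((lev_fcomm_le hX t).trans (by omega)) ((lev_fcomm_le hX u).trans (by omega))
  | Sym.comp t u => by
    simp only [fcomm, lev_add, lev_comp]
    refine max_le (max_le ((lev_fcomm_le hX t).trans (by omega)) (by omega))
      (max_le (by omega) ((lev_fcomm_le hX u).trans (by omega)))

/-- The bracket of an elementary field `A lin v` with `Λ^b`. [folklore] -/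
theorem comm_single_bessel {A : Sym V} (hA : IsCoef A) (hcA : Cert A) (v : V) (b : ℝ) :
    Sym.comm (comp A (lin v)) (bessel b) ≈ comp (bcomm b A) (lin v) := by
  refine (comp_comm hcA (cert_lin v) (cert_bessel b)).trans ?_
  refine ((((isMul_lin v).comm_equiv_zero (isMul_bessel b)).comp_right A).add
    ((hA.comm_bessel b hcA).comp_left (cert_lin v))).trans ?_
  exact ((comp_zero' A).add Sym.Equiv.rfl).trans (zero_add' _)

/-- The bracket of an elementary field `A lin v` with `lin w`. [folklore] -/
theorem comm_single_lin {A : Sym V} (hA : IsCoef A) (hcA : Cert A) (v w : V) :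
    Sym.comm (comp A (lin v)) (lin w) ≈ comp (neg (lcomm w A)) (lin v) := by
  refine (comp_comm hcA (cert_lin v) (cert_lin w)).trans ?_
  refine ((((isMul_lin v).comm_equiv_zero (isMul_lin w)).comp_right A).add
    ((hA.comm_lin_right w hcA).comp_left (cert_lin v))).trans ?_
  exact ((comp_zero' A).add Sym.Equiv.rfl).trans (zero_add' _)

/-- The bracket of an elementary field `A lin v` with `conv θ`. [folklore] -/
theorem comm_single_conv {A : Sym V} (hA : IsCoef A) (hcA : Cert A) (v : V) {θ : V → ℂ}
    {D : ℕ → ℝ} (hθ : RapidDecay θ D) :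
    Sym.comm (comp A (lin v)) (conv θ) ≈ comp A (conv fun ζ => linMul v ζ * θ ζ) := by
  refine (comp_comm (u := conv θ) hcA (cert_lin v) ⟨D, hθ⟩).trans ?_
  refine (((comm_lin_conv v hθ).comp_right A).add
    (((comm_antisymm _ _).trans (IsCoef.comm_conv_left hθ hA hcA).neg).comp_left
      (cert_lin v))).trans ?_
  refine (Sym.Equiv.rfl.add ((neg_zero''.comp_left (cert_lin v)).trans (zero_comp' _))).trans ?_
  exact add_zero' _
where
  /-- `-0 ≈ 0` [folklore] -/
  neg_zero'' : neg (Sym.zero : Sym V) ≈ Sym.zero := fun F _ => by ext ξ; simp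

/-- The bracket of an elementary field `A lin v` with `gcomm1 b θ`. [folklore] -/
theorem comm_single_gcomm1 {A : Sym V} (hA : IsCoef A) (hcA : Cert A) (v : V) (b : ℝ)
    {θ : V → ℂ} {D : ℕ → ℝ} (hθ : RapidDecay θ D) :
    Sym.comm (comp A (lin v)) (gcomm1 b θ) ≈
      add (comp A (gcomm1 b fun ζ => linMul v ζ * θ ζ)) (comp (g1comm b θ A) (lin v)) := by
  refine (comp_comm (u := gcomm1 b θ) hcA (cert_lin v) ⟨D, hθ⟩).trans ?_
  exact ((comm_lin_gcomm1 v b hθ).comp_right A).add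
    ((hA.comm_gcomm1 b hθ hcA).comp_left (cert_lin v))

/-- **`[X, T] ≈ fcomm X T`** for a field `X` and `T` of level `≤ 1`. [folklore] -/
theorem comm_fcomm {X : Field V} (hX : IsField X) (hcX : CertF X) :
    ∀ {T : Sym V}, lev T ≤ 1 → Cert T → Sym.comm (toSym X) T ≈ fcomm X T
  | bessel b, _, _ => by
    refine (comm_sum_left (map_cert hcX) (cert_bessel b)).trans ?_
    rw [List.map_map]
    exact sum_map_equiv fun p hp => comm_single_bessel (hX p hp) (hcX p hp) p.2 b
  | lin w, _, _ => by
    refine (comm_sum_left (map_cert hcX) (cert_lin w)).trans ?_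
    rw [List.map_map]
    exact sum_map_equiv fun p hp => comm_single_lin (hX p hp) (hcX p hp) p.2 w
  | cmul c, _, _ => (comm_cmul_right _ c).zeroOf _
  | conv θ, _, ⟨D, hθ⟩ => by
    refine (comm_sum_left (t := conv θ) (map_cert hcX) ⟨D, hθ⟩).trans ?_
    rw [List.map_map]
    exact sum_map_equiv fun p hp => comm_single_conv (hX p hp) (hcX p hp) p.2 hθ
  | gcomm1 b θ, _, ⟨D, hθ⟩ => by
    refine (comm_sum_left (t := gcomm1 b θ) (map_cert hcX) ⟨D, hθ⟩).trans ?_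
    rw [List.map_map]
    exact sum_map_equiv fun p hp => comm_single_gcomm1 (hX p hp) (hcX p hp) p.2 b hθ
  | gcomm2 _ _ _, h, _ => by simp at h
  | smul c t, hl, ht =>
    (comm_smul_right c _ t).trans ((comm_fcomm hX hcX (T := t) hl ht).smul c)
  | add t u, hl, ⟨ht, hu⟩ => by
    simp only [lev_add, max_le_iff] at hl
    exact (comm_add_right hcX.cert_toSym ht hu).trans
      ((comm_fcomm hX hcX hl.1 ht).add (comm_fcomm hX hcX hl.2 hu))
  | Sym.comp t u, hl, ⟨ht, hu⟩ => by
    simp only [lev_comp, max_le_iff] at hl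
    exact (comm_comp hcX.cert_toSym ht hu).trans
      (((comm_fcomm hX hcX hl.1 ht).comp_left hu).add ((comm_fcomm hX hcX hl.2 hu).comp_right t))
where
  /-- the terms of `toSym X` are certified [folklore] -/
  map_cert {X : Field V} (hcX : CertF X) :
      ∀ s ∈ X.map (fun p => comp p.1 (lin p.2)), Cert s := fun s hs => by
    obtain ⟨p, hp, rfl⟩ := List.mem_map.1 hs
    exact ⟨hcX p hp, trivial⟩

/-- **The double commutator** `[X, [X, T]] ≈ fcomm X (fcomm X T)` for plain `T`: an expression
of order `≤ ord T` (`[X, [X, Λ^b]]` has order `b`). [folklore] -/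
theorem comm_comm_fcomm {X : Field V} (hX : IsField X) (hcX : CertF X) (hne : X ≠ [])
    {T : Sym V} (hT : Plain T) (hcT : Cert T) :
    Sym.comm (toSym X) (Sym.comm (toSym X) T) ≈ fcomm X (fcomm X T) ∧
      ord (fcomm X (fcomm X T)) ≤ ord T := by
  have hl1 : lev (fcomm X T) ≤ 1 := (lev_fcomm_le hX T).trans (by simp [hT.lev_eq])
  refine ⟨?_, (ord_fcomm_le hX hne _).trans (ord_fcomm_le hX hne T)⟩
  exact (Sym.Equiv.rfl.comm (comm_fcomm hX hcX (by simp [hT.lev_eq]) hcT) hcX.cert_toSym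
    ((cert_comm_iff _ _).2 ⟨hcX.cert_toSym, hcT⟩)).trans
    (comm_fcomm hX hcX hl1 (hcX.fcomm_cert hX hcT))

end Field

end Literature.Analysis.Hypoelliptic
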